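import Summits.BirchSwinnertonDyer.BirchSwinnertonDyer.Theorems.OneSidedTwistSqueezeX9KatoDivisibilityX9LocalExponentPk
import Summits.BirchSwinnertonDyer.BirchSwinnertonDyer.Theorems.SmallImageMuTransferMuTransferX9LocalExponentBadPrimesUniform
import Literature.NumberTheory.EllipticCurves.IwasawaTwistModPkTower
import Literature.NumberTheory.EllipticCurves.IwasawaTwistModPkToOmegaSq
import Literature.NumberTheory.EllipticCurves.IwasawaTwistModPDual
import HarnessLib

/-!
# Line `graded_euler_loss` of crux `KatoDivisibilityX9` (stmt-BirchSwinnertonDyer-20547), stub 1a' `stub_testCocyclePkLevelX9`,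
# local clause at `v ∈ S ∖ {p}` — file 2 of 2: the UNIFORM LOCAL EXPONENT at level `p^k` (ONE `ε`: `loc_v(T^{ε'} Ψ) = 0`
# for all `ε' ≥ ε`, `v ∈ S ∖ {p}`, ALL levels `J`, ALL `Ψ ∈ H¹(K, 𝒯^{(k)}_J)`), in the `shiftH1Pk` spelling and in
# the stub's `twistModPkShiftEmbed ∘ twistModPkTruncate` spelling

Seat `bsd-line-k6-p4` (prover-bsd-line-k6-p4-g5-0, 5th LEAD on the crux).  THEOREMS ONLY — no definition, no named fact, no
`sorry`; credits nothing (`--supports … --as helper`).  Level-`p^k` port of `…X9LocalExponentBadPrimesUniform` + `…Curve`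
(k6-g4, level `p`) on top of file 1 (`…KatoDivisibilityX9LocalExponentPk`: `#H¹(K_v, 𝒯^{(k)}_J) ≤ #M^{2·p^m}`, `p`-group
exponent lemma).  §4 `T_v` nilpotent; **`T_v^[2d·p^m] = 0`** (`#M = p^d`, `g` `ρ`-trivial of depth `m` fixing `μ_{p^k}`);
global form.  §5 such a `g` from any `τ` with `κ(res τ) ≠ 1`.  §6–§7 `∃ ε_v ∀ J`, cyclotomic case over a finite set of
places.  §8 `H¹(T^{a}·) ∘ H¹(mod T^{J−a}) = T^[a]` on `H¹(K, 𝒯^{(k)}_J)` and the elliptic corollaries for the DUAL twist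
`W.modPkTwist p k κ.invTwist J` in both spellings — literally the `v ∈ S`, `v ∤ p` instances of the last conjunct of
`stub_testCocyclePkLevelX9` (`k = d + 1`, `J = L`), for EVERY class (no test-pair input is needed away from `p`).
NOT HERE (honest): the clause AT `p` (fine condition under the level-`p^k` dictionary) and unramifiedness outside `S`.
Closes nothing; BSD is not proved by any of this; no summit statement is proved by this seat.
References: J. S. Milne, *Arithmetic Duality Theorems* (2006) I Thm. 2.8 [MilneADT2006]; J.-P. Serre, *Galois Cohomology*
I §2.2–2.4, II §5.7 [SerreGaloisCohomology1997]; R. Greenberg, LNM 1716 (1999) §1 [GreenbergLNM1716]; B. Mazur, K. Rubin,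
Mem. AMS 799 (2004) Lemma 5.3.1 [MazurRubin2004]; L. Washington, GTM 83 §13.1–13.2 [Washington1997].
-/

set_option linter.dupNamespace false
set_option autoImplicit false

noncomputable section

open scoped Classical ContRepresentation

universe u

namespace Summit.BirchSwinnertonDyer.BirchSwinnertonDyer.Theorems.OneSidedTwistSqueezeX9KatoDivisibilityX9LocalExponentPkUniform

open Summit.BirchSwinnertonDyer.BirchSwinnertonDyer.Rank1Residual.LocalSplitPrime
open Summit.BirchSwinnertonDyer.BirchSwinnertonDyer.Theorems.OneSidedTwistSqueezeX9KatoDivisibilityX9LocalExponentPk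
open CategoryTheory ContinuousCohomology Function Field ValuativeRel NumberField IsDedekindDomain
open Literature.NumberTheory.GaloisRepresentations
open Literature.NumberTheory.GaloisRepresentations.IsNonarchimedeanLocalField
open _root_.TopRep
open Literature.NumberTheory.GaloisCohomology
open Literature.NumberTheory.EllipticCurves

/-! ## §4 The uniform local exponent: `T_v^{2d·p^m}` kills `H¹(K_v, 𝒯^{(k)}_J)` for every `J` -/

section Exponent

variable {K : Type u} [Field K] [NumberField K] {M : Type u} [AddCommGroup M] [TopologicalSpace M]
  [DiscreteTopology M] [Finite M] (ρ : DiscreteGaloisModule K M) {p : ℕ} [Fact p.Prime] {k : ℕ}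
  (hM : ∀ x : M, p ^ k • x = 0) (κ : ZpExtension K p) (J : ℕ) (v : HeightOneSpectrum (𝓞 K))

omit [Finite M] in
/-- The local shift `T_v = H¹(K_v, S)` on `H¹(K_v, 𝒯^{(k)}_J)` is nilpotent: `T_v^[a] [φ] = [S^a ∘ φ]`, hence
`T_v^[a] = 0` for `a ≥ J` (`S^J = 0` on `𝒯^{(k)}_J`; local form of `ZpExtension.shiftH1Pk_iterate_eq_zero`).
[cite: Washington1997, §13.1–§13.2] [cite: SerreGaloisCohomology1997, I §2.2] -/
theorem localShiftPk_iterate_eq_zero_of_le {a : ℕ} (ha : J ≤ a)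
    (c : galoisCohomology (GaloisRep.toLocal v (κ.twistModPk ρ hM J)) 1) :
    (galoisCohomology.map ((κ.twistModPkShift ρ hM J).restrictField (v.adicCompletion K)) 1)^[a] c = 0 := by
  -- `T_v^[a] [φ] = [ψ]` with `ψ = S^a ∘ φ`
  have hiter : ∀ (a : ℕ) (φ : contOneCocycles (GaloisRep.toLocal v (κ.twistModPk ρ hM J)).toTopRep),
      ∃ ψ : contOneCocycles (GaloisRep.toLocal v (κ.twistModPk ρ hM J)).toTopRep,
      (∀ x, ψ.1 x = (shiftEnd M J ^ a) (φ.1 x)) ∧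
        (galoisCohomology.map ((κ.twistModPkShift ρ hM J).restrictField (v.adicCompletion K)) 1)^[a]
          (oneCocycleClass _ φ) = oneCocycleClass _ ψ := by
    intro a
    induction a with
    | zero => exact fun φ => ⟨φ, fun x => by simp, rfl⟩
    | succ a ih =>
      intro φ
      obtain ⟨ψ, hψ, hk⟩ := ih φ
      obtain ⟨ψ', hψ', hmap⟩ := galoisCohomology_map_oneCocycleClass _ _
        ((κ.twistModPkShift ρ hM J).restrictField (v.adicCompletion K)) ψ
      refine ⟨ψ', fun x => ?_, ?_⟩
      · rw [hψ', pow_succ', Module.End.mul_apply, ← hψ]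
        rfl
      · rw [Function.iterate_succ_apply', hk]
        exact hmap
  obtain ⟨φ, rfl⟩ := oneCocycleClass_surjective _ c
  obtain ⟨ψ, hψ, hψk⟩ := hiter a φ
  refine hψk.trans ((oneCocycleClass_eq_zero_iff _ ψ).2 ⟨0, fun x => ?_⟩)
  rw [hψ, shiftEnd_pow_eq_zero ha, LinearMap.zero_apply, map_zero, sub_zero]

/-- **THE UNIFORM LOCAL EXPONENT AT LEVEL `p^k`.**  Let `v ∤ p` be a finite place of `K`, `#M = p^d`
(`p^k • M = 0`), and `g ∈ Γ_{K_v}` an element with `ρ(res g) = 1`, fixing the `p^k`-th roots of unity, of depth `m`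
in the `ℤ_p`-tower of `κ`.  Then for EVERY level `J` and every class `c ∈ H¹(K_v, 𝒯^{(k)}_J)`:
`T_v^[2·d·p^m] c = 0` (`H¹(K_v, 𝒯^{(k)}_J)` is a finite abelian `p`-group of order `≤ p^{2d·p^m}` by file 1 §3, on
which `T_v` is nilpotent; file 1 §0).  For `M = E[p^k]` (`d = 2k`) this is `ε_v = 4k·p^m`, independent of `J`.
[cite: MilneADT2006, Ch. I §2, Thm. 2.8 (p. 31)] [cite: MazurRubin2004, Lemma 5.3.1] -/
theorem localShiftPk_iterate_eq_zero_of_depth (hpv : (p : 𝓞 K) ∉ v.asIdeal) {d : ℕ}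
    (hcard : Nat.card M = p ^ d)
    {g : absoluteGaloisGroup (v.adicCompletion K)}
    (hg : ρ (absGaloisRestrict K (v.adicCompletion K) g) = 1)
    (hμ : ∀ ζ : (AlgebraicClosure (v.adicCompletion K))ˣ, ζ ^ (p ^ k) = 1 → g • ζ = ζ) {m : ℕ}
    (hgm : absGaloisRestrict K (v.adicCompletion K) g ∈ κ.layerSubgroup m)
    (hgm' : absGaloisRestrict K (v.adicCompletion K) g ∉ κ.layerSubgroup (m + 1))
    (c : galoisCohomology (GaloisRep.toLocal v (κ.twistModPk ρ hM J)) 1) :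
    (galoisCohomology.map ((κ.twistModPkShift ρ hM J).restrictField (v.adicCompletion K)) 1)^[2 * d * p ^ m]
      c = 0 := by
  haveI : CharZero (v.adicCompletion K) := charZero_adicCompletion v
  haveI : Finite (galoisCohomology (GaloisRep.toLocal v (κ.twistModPk ρ hM J)) 1) :=
    finite_galoisCohomology_one_of_isNonarchimedeanLocalField _
  have hMJ : ∀ x : Fin J → M, p ^ k • x = 0 := fun x => funext fun i => hM (x i)
  refine iterate_eq_zero_of_nilpotent_of_natCard_le_of_pow_smul k _
    (galoisCohomology.nsmul_eq_zero_of_forall (GaloisRep.toLocal v (κ.twistModPk ρ hM J)) hMJ) _ J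
    (localShiftPk_iterate_eq_zero_of_le ρ hM κ J v le_rfl) _ ?_ c
  calc Nat.card (galoisCohomology (GaloisRep.toLocal v (κ.twistModPk ρ hM J)) 1)
      ≤ Nat.card M ^ (2 * p ^ m) :=
        natCard_galoisCohomology_one_toLocal_twistModPk_le_of_depth ρ hM κ J v hpv hg hμ hgm hgm'
    _ = p ^ (2 * d * p ^ m) := by rw [hcard, ← pow_mul]; ring_nf

/-- **Global form**: for a GLOBAL class `y ∈ H¹(K, 𝒯^{(k)}_J)`, the localisation at `v` of `T^[2·d·p^m] y`
(`ZpExtension.shiftH1Pk`) vanishes — `loc_v` commutes with the shift (`galoisCohomology.res_map_one`).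
[cite: MilneADT2006, Ch. I §2, Thm. 2.8 (p. 31)] [cite: SerreGaloisCohomology1997, I §2.4] -/
theorem localization_shiftH1Pk_iterate_eq_zero_of_depth (hpv : (p : 𝓞 K) ∉ v.asIdeal) {d : ℕ}
    (hcard : Nat.card M = p ^ d)
    {g : absoluteGaloisGroup (v.adicCompletion K)}
    (hg : ρ (absGaloisRestrict K (v.adicCompletion K) g) = 1)
    (hμ : ∀ ζ : (AlgebraicClosure (v.adicCompletion K))ˣ, ζ ^ (p ^ k) = 1 → g • ζ = ζ) {m : ℕ}
    (hgm : absGaloisRestrict K (v.adicCompletion K) g ∈ κ.layerSubgroup m)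
    (hgm' : absGaloisRestrict K (v.adicCompletion K) g ∉ κ.layerSubgroup (m + 1))
    (y : galoisCohomology (κ.twistModPk ρ hM J) 1) :
    galoisCohomology.localization (κ.twistModPk ρ hM J) (Sum.inr v) 1
      ((κ.shiftH1Pk ρ hM J)^[2 * d * p ^ m] y) = 0 := by
  -- localisation commutes with the shift
  have hcomm : ∀ (a : ℕ) (z : galoisCohomology (κ.twistModPk ρ hM J) 1),
      galoisCohomology.localization (κ.twistModPk ρ hM J) (Sum.inr v) 1 ((κ.shiftH1Pk ρ hM J)^[a] z) =
        (galoisCohomology.map ((κ.twistModPkShift ρ hM J).restrictField (v.adicCompletion K)) 1)^[a]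
          (galoisCohomology.localization (κ.twistModPk ρ hM J) (Sum.inr v) 1 z) := by
    intro a
    induction a with
    | zero => intro z; rfl
    | succ a ih =>
      intro z
      rw [Function.iterate_succ_apply', Function.iterate_succ_apply', ← ih]
      exact galoisCohomology.res_map_one (v.adicCompletion K) (κ.twistModPkShift ρ hM J) _
  rw [hcomm]
  exact localShiftPk_iterate_eq_zero_of_depth ρ hM κ J v hpv hcard hg hμ hgm hgm' _

end Exponent

/-! ## §5 Existence of the auxiliary element: any `τ ∈ Γ_{K_v}` on which `κ` is non-trivial -/

section Existence

variable {K : Type u} [Field K] [NumberField K] {M : Type u} [AddCommGroup M] [TopologicalSpace M]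
  [DiscreteTopology M] [Finite M] (ρ : DiscreteGaloisModule K M) {p : ℕ} [Fact p.Prime] (k : ℕ)
  (κ : ZpExtension K p) (v : HeightOneSpectrum (𝓞 K))

/-- **The auxiliary element at level `p^k` exists as soon as `κ` is non-trivial on `Γ_{K_v}`.**  Given
`τ ∈ Γ_{K_v}` with `κ(res τ) ≠ 1`, the power `g = τ^{N₁N₂}` — `N₁` the order of `ρ(res τ)` in the finite group `Aut(M)`,
`N₂` the order of `τ` on the finite set `μ_{p^k}(K̄_v)` — acts trivially on `M` and on `μ_{p^k}`, and
`κ(res g) = κ(res τ)^{N₁N₂} ≠ 1` (`ℤ_p` is torsion-free), so `g` has a finite depth `m`.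
[cite: Washington1997, §13.1–§13.2] -/
theorem exists_trivial_depth_of_apply_ne_one_pk (τ : absoluteGaloisGroup (v.adicCompletion K))
    (hτ : κ (absGaloisRestrict K (v.adicCompletion K) τ) ≠ 1) :
    ∃ (g : absoluteGaloisGroup (v.adicCompletion K)) (m : ℕ),
      ρ (absGaloisRestrict K (v.adicCompletion K) g) = 1 ∧
      (∀ ζ : (AlgebraicClosure (v.adicCompletion K))ˣ, ζ ^ (p ^ k) = 1 → g • ζ = ζ) ∧
      absGaloisRestrict K (v.adicCompletion K) g ∈ κ.layerSubgroup m ∧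
      absGaloisRestrict K (v.adicCompletion K) g ∉ κ.layerSubgroup (m + 1) := by
  set F := v.adicCompletion K
  haveI : NeZero (p ^ k) := ⟨pow_ne_zero _ (Fact.out : p.Prime).ne_zero⟩
  -- `N₁`: the order of `ρ(res τ)` in the finite group of units of `End(M)`
  haveI : Finite (M →ₗ[ℤ] M) := Finite.of_injective (fun f => (f : M → M)) DFunLike.coe_injective
  haveI : Finite (M →ₗ[ℤ] M)ˣ := Finite.of_injective _ Units.val_injective
  set u₁ := Representation.asGroupHom ρ.toRepresentation (absGaloisRestrict K F τ) with hu₁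
  set N₁ := orderOf u₁ with hN₁
  have hN₁pos : 0 < N₁ := orderOf_pos u₁
  have h1 : ρ (absGaloisRestrict K F τ) ^ N₁ = 1 := by
    have h := congrArg (fun w : (M →ₗ[ℤ] M)ˣ => (w : M →ₗ[ℤ] M)) (pow_orderOf_eq_one u₁)
    simp only [Units.val_pow_eq_pow_val, Units.val_one] at h
    exact h
  -- `N₂`: the order of `τ` acting on the finite set `μ_{p^k}(F̄)`
  haveI : Finite (rootsOfUnity (p ^ k) (AlgebraicClosure F)) := inferInstance
  set u₂ := MulAction.toPermHom (absoluteGaloisGroup F) (rootsOfUnity (p ^ k) (AlgebraicClosure F)) τ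
    with hu₂
  set N₂ := orderOf u₂ with hN₂
  have hN₂pos : 0 < N₂ := orderOf_pos u₂
  have h2 : ∀ ζ : rootsOfUnity (p ^ k) (AlgebraicClosure F), (τ ^ N₂) • ζ = ζ := fun ζ => by
    have h := pow_orderOf_eq_one u₂
    rw [← hN₂, hu₂, ← map_pow] at h
    have h' := Equiv.congr_fun h ζ
    simpa only [MulAction.toPermHom_apply, MulAction.toPerm_apply, Equiv.Perm.coe_one, id_eq] using h'
  -- the element
  refine ⟨τ ^ (N₁ * N₂), PadicInt.valuation ((κ (absGaloisRestrict K F (τ ^ (N₁ * N₂)))).toAdd),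
    ?_, ?_, ?_, ?_⟩
  · rw [map_pow, map_pow, pow_mul, h1, one_pow]
  · intro ζ hζ
    have hmem : ζ ∈ rootsOfUnity (p ^ k) (AlgebraicClosure F) := (mem_rootsOfUnity _ _).2 hζ
    have h := h2 ⟨ζ, hmem⟩
    have h' : (τ ^ (N₁ * N₂)) • (⟨ζ, hmem⟩ : rootsOfUnity (p ^ k) (AlgebraicClosure F)) = ⟨ζ, hmem⟩ := by
      rw [mul_comm, pow_mul]
      -- `(τ^{N₂})^{N₁}` acts trivially since `τ^{N₂}` does
      induction N₁ with
      | zero => rw [pow_zero, one_smul]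
      | succ n ih => rw [pow_succ, mul_smul, h, ih]
    have := congrArg (fun z : rootsOfUnity (p ^ k) (AlgebraicClosure F) => (z : (AlgebraicClosure F)ˣ)) h'
    simpa only [absoluteGaloisGroup.coe_smul_rootsOfUnity] using this
  · -- `p^m ∣ κ(res g)` with `m` the valuation
    have hx : (κ (absGaloisRestrict K F (τ ^ (N₁ * N₂)))).toAdd ≠ 0 := by
      rw [map_pow, map_pow, toAdd_pow, nsmul_eq_mul]
      refine mul_ne_zero (Nat.cast_ne_zero.2 (Nat.mul_pos hN₁pos hN₂pos).ne') fun h => hτ ?_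
      rw [← ofAdd_toAdd (κ _), h, ofAdd_zero]
    rw [ZpExtension.mem_layerSubgroup, ← Ideal.mem_span_singleton,
      PadicInt.mem_span_pow_iff_le_valuation _ hx]
  · have hx : (κ (absGaloisRestrict K F (τ ^ (N₁ * N₂)))).toAdd ≠ 0 := by
      rw [map_pow, map_pow, toAdd_pow, nsmul_eq_mul]
      refine mul_ne_zero (Nat.cast_ne_zero.2 (Nat.mul_pos hN₁pos hN₂pos).ne') fun h => hτ ?_
      rw [← ofAdd_toAdd (κ _), h, ofAdd_zero]
    rw [ZpExtension.mem_layerSubgroup, ← Ideal.mem_span_singleton,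
      PadicInt.mem_span_pow_iff_le_valuation _ hx]
    omega

end Existence

/-! ## §6 Packaging: a uniform exponent `ε_v`, for all levels `J` at once -/

section Uniform

variable {K : Type u} [Field K] [NumberField K] {M : Type u} [AddCommGroup M] [TopologicalSpace M]
  [DiscreteTopology M] [Finite M] (ρ : DiscreteGaloisModule K M) {p : ℕ} [Fact p.Prime] {k : ℕ}
  (hM : ∀ x : M, p ^ k • x = 0) (κ : ZpExtension K p) (v : HeightOneSpectrum (𝓞 K))

/-- **Uniform local exponent at level `p^k`, existential form.**  At a finite place `v ∤ p` at which `κ` is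
non-trivial (witness: any `τ ∈ Γ_{K_v}` with `κ(res τ) ≠ 1`) there is ONE exponent `ε_v` such that for EVERY level
`J`, every `ε ≥ ε_v` and every class `c ∈ H¹(K_v, 𝒯^{(k)}_J)`: `T_v^[ε] c = 0`.
[cite: MilneADT2006, Ch. I §2, Thm. 2.8 (p. 31)] [cite: Washington1997, §13.1–§13.2] -/
theorem exists_uniform_localShiftPk_iterate_eq_zero (hpv : (p : 𝓞 K) ∉ v.asIdeal)
    (τ : absoluteGaloisGroup (v.adicCompletion K))
    (hτ : κ (absGaloisRestrict K (v.adicCompletion K) τ) ≠ 1) :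
    ∃ εv : ℕ, ∀ ⦃ε : ℕ⦄, εv ≤ ε → ∀ (J : ℕ)
      (c : galoisCohomology (GaloisRep.toLocal v (κ.twistModPk ρ hM J)) 1),
      (galoisCohomology.map ((κ.twistModPkShift ρ hM J).restrictField (v.adicCompletion K)) 1)^[ε] c = 0 := by
  obtain ⟨d, hd⟩ := exists_card_eq_prime_pow M (fun x => ⟨k, hM x⟩)
  obtain ⟨g, m, hg, hμ, hgm, hgm'⟩ := exists_trivial_depth_of_apply_ne_one_pk ρ k κ v τ hτ
  refine ⟨2 * d * p ^ m, fun ε hε J c => ?_⟩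
  obtain ⟨r, rfl⟩ := Nat.exists_eq_add_of_le hε
  rw [Function.iterate_add_apply]
  exact localShiftPk_iterate_eq_zero_of_depth ρ hM κ J v hpv hd hg hμ hgm hgm' _

/-- **Uniform local exponent at level `p^k`, global form** (the shape «`loc_v (T^[ε] Ψ) = 0` for `v ∈ S ∖ {p}`,
uniformly in `J`»): at a finite place `v ∤ p` with `κ|_{Γ_{K_v}} ≠ 1` there is `ε_v` such that for every level `J`,
every `ε ≥ ε_v` and every GLOBAL class `y ∈ H¹(K, 𝒯^{(k)}_J)`, `loc_v (T^[ε] y) = 0` (`ZpExtension.shiftH1Pk`,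
`galoisCohomology.localization`). [cite: MilneADT2006, Ch. I §2, Thm. 2.8 (p. 31)] [cite: SerreGaloisCohomology1997, I §2.4] -/
theorem exists_uniform_localization_shiftH1Pk_iterate_eq_zero (hpv : (p : 𝓞 K) ∉ v.asIdeal)
    (τ : absoluteGaloisGroup (v.adicCompletion K))
    (hτ : κ (absGaloisRestrict K (v.adicCompletion K) τ) ≠ 1) :
    ∃ εv : ℕ, ∀ ⦃ε : ℕ⦄, εv ≤ ε → ∀ (J : ℕ) (y : galoisCohomology (κ.twistModPk ρ hM J) 1),
      galoisCohomology.localization (κ.twistModPk ρ hM J) (Sum.inr v) 1 ((κ.shiftH1Pk ρ hM J)^[ε] y) = 0 := by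
  obtain ⟨d, hd⟩ := exists_card_eq_prime_pow M (fun x => ⟨k, hM x⟩)
  obtain ⟨g, m, hg, hμ, hgm, hgm'⟩ := exists_trivial_depth_of_apply_ne_one_pk ρ k κ v τ hτ
  refine ⟨2 * d * p ^ m, fun ε hε J y => ?_⟩
  obtain ⟨r, rfl⟩ := Nat.exists_eq_add_of_le hε
  rw [Function.iterate_add_apply]
  exact localization_shiftH1Pk_iterate_eq_zero_of_depth ρ hM κ J v hpv hd hg hμ hgm hgm' _

end Uniform

/-! ## §7 The cyclotomic `ℤ_p`-extension: `κ` is non-trivial on EVERY decomposition group -/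

section Cyclotomic

variable {K : Type} [Field K] [NumberField K] {M : Type} [AddCommGroup M] [TopologicalSpace M]
  [DiscreteTopology M] [Finite M] (ρ : DiscreteGaloisModule K M) {p : ℕ} [Fact p.Prime] {k : ℕ}
  (hM : ∀ x : M, p ^ k • x = 0) (κ : ZpExtension K p)

/-- **Cyclotomic case, one place** (no finite place splits completely in the cyclotomic `ℤ_p`-extension, tree
`exists_apply_resGal_ne_one_of_isCyclotomic'`): at every `v ∤ p` there is `ε_v` with `loc_v (T^[ε] y) = 0` for all
`ε ≥ ε_v`, all levels `J` and all global `y ∈ H¹(K, 𝒯^{(k)}_J)`. [cite: GreenbergLNM1716, §1] [cite: Washington1997, §13.1] -/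
theorem exists_uniform_localization_shiftH1Pk_iterate_eq_zero_of_isCyclotomic (hκ : κ.IsCyclotomic)
    (v : HeightOneSpectrum (𝓞 K)) (hpv : (p : 𝓞 K) ∉ v.asIdeal) :
    ∃ εv : ℕ, ∀ ⦃ε : ℕ⦄, εv ≤ ε → ∀ (J : ℕ) (y : galoisCohomology (κ.twistModPk ρ hM J) 1),
      galoisCohomology.localization (κ.twistModPk ρ hM J) (Sum.inr v) 1 ((κ.shiftH1Pk ρ hM J)^[ε] y) = 0 := by
  obtain ⟨τ, hτ⟩ := exists_apply_resGal_ne_one_of_isCyclotomic' K p hκ v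
  exact exists_uniform_localization_shiftH1Pk_iterate_eq_zero ρ hM κ v hpv τ hτ

/-- **Cyclotomic case, a finite set of places away from `p`: ONE `ε` for all `v ∈ S` and all `J`.**
[cite: GreenbergLNM1716, §1] [cite: MilneADT2006, Ch. I §2, Thm. 2.8 (p. 31)] -/
theorem exists_uniform_localization_shiftH1Pk_iterate_eq_zero_finset_of_isCyclotomic
    (hκ : κ.IsCyclotomic) (S : Finset (HeightOneSpectrum (𝓞 K)))
    (hS : ∀ v ∈ S, (p : 𝓞 K) ∉ v.asIdeal) :
    ∃ ε : ℕ, ∀ ⦃ε' : ℕ⦄, ε ≤ ε' → ∀ v ∈ S, ∀ (J : ℕ) (y : galoisCohomology (κ.twistModPk ρ hM J) 1),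
      galoisCohomology.localization (κ.twistModPk ρ hM J) (Sum.inr v) 1 ((κ.shiftH1Pk ρ hM J)^[ε'] y)
        = 0 := by
  classical
  have hch : ∀ v : HeightOneSpectrum (𝓞 K), ∃ εv : ℕ, v ∈ S → ∀ ⦃ε : ℕ⦄, εv ≤ ε →
      ∀ (J : ℕ) (y : galoisCohomology (κ.twistModPk ρ hM J) 1),
        galoisCohomology.localization (κ.twistModPk ρ hM J) (Sum.inr v) 1 ((κ.shiftH1Pk ρ hM J)^[ε] y)
          = 0 := by
    intro v
    by_cases hv : v ∈ S
    · obtain ⟨εv, h⟩ :=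
        exists_uniform_localization_shiftH1Pk_iterate_eq_zero_of_isCyclotomic ρ hM κ hκ v (hS v hv)
      exact ⟨εv, fun _ => h⟩
    · exact ⟨0, fun h => absurd h hv⟩
  choose f hf using hch
  refine ⟨S.sup f, fun ε' hε' v hv J y => hf v hv ((Finset.le_sup hv).trans hε') J y⟩

end Cyclotomic

/-! ## §8 The `twistModPkShiftEmbed ∘ twistModPkTruncate` spelling of `T^[a]` on `H¹`, and the elliptic corollaries
for the dual twist `W.modPkTwist p k κ.invTwist J` -/

section ShiftEmbedTruncate

variable {K : Type u} [Field K] {M : Type u} [AddCommGroup M] [TopologicalSpace M]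
  [DiscreteTopology M] (ρ : DiscreteGaloisModule K M) {p : ℕ} [Fact p.Prime] {k : ℕ}
  (hM : ∀ x : M, p ^ k • x = 0) (κ : ZpExtension K p) (J : ℕ)

/-- **`H¹(T^{a}·) ∘ H¹(mod T^{J−a}) = T^[a]` on `H¹(K, 𝒯^{(k)}_J)`**: the composite
`galoisCohomology.map (twistModPkShiftEmbed J (J−a)) ∘ galoisCohomology.map (twistModPkTruncate J (J−a))` — the
spelling in which `stub_testCocyclePkLevelX9` states its local conditions — is the `a`-th iterate of
`ZpExtension.shiftH1Pk` (both send `[φ]` to `[S^a ∘ φ]`, `twistModPkShiftEmbed_twistModPkTruncate_apply`).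
[cite: Washington1997, §13.1–§13.2] [cite: SerreGaloisCohomology1997, I §2.2] -/
theorem map_twistModPkShiftEmbed_map_twistModPkTruncate_eq_shiftH1Pk_iterate (a : ℕ)
    (c : galoisCohomology (κ.twistModPk ρ hM J) 1) :
    galoisCohomology.map (κ.twistModPkShiftEmbed ρ hM J (Nat.sub_le J a)) 1
        (galoisCohomology.map (κ.twistModPkTruncate ρ hM J (Nat.sub_le J a)) 1 c) =
      (κ.shiftH1Pk ρ hM J)^[a] c := by
  obtain ⟨φ, rfl⟩ := oneCocycleClass_surjective _ c
  rw [ZpExtension.shiftH1Pk_iterate_oneCocycleClass,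
    galoisCohomology.map_map_of_comp_apply _ _
      ((κ.twistModPkShiftEmbed ρ hM J (Nat.sub_le J a)).comp (κ.twistModPkTruncate ρ hM J (Nat.sub_le J a)))
      (fun _ => rfl),
    galoisCohomology.map_oneCocycleClass_ofHom]
  congr 1
  refine Subtype.ext (ContinuousMap.ext fun σ => ?_)
  change κ.twistModPkShiftEmbed ρ hM J (Nat.sub_le J a)
      (κ.twistModPkTruncate ρ hM J (Nat.sub_le J a) (φ.1 σ)) = (shiftEnd M J ^ a) (φ.1 σ)
  exact ZpExtension.twistModPkShiftEmbed_twistModPkTruncate_apply κ ρ hM J a (φ.1 σ)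

end ShiftEmbedTruncate

section Curve

open _root_.WeierstrassCurve

variable {K : Type} [Field K] [NumberField K] (W : WeierstrassCurve K) [W.IsElliptic]
  (p : ℕ) [Fact p.Prime] (k : ℕ) (κ : ZpExtension K p)

/-- **The uniform local exponent for the DUAL level-`p^k` twist `𝒯^{(k)}_J(E, κ⁻¹) = W.modPkTwist p k κ.invTwist J`,
finite-`Set` spelling** (the shape of `stub_testCocyclePkLevelX9`: `∃ ε S, S.Finite ∧ …`): for `κ` cyclotomic and a
finite set `S` of places, ONE `ε` with `loc_v ((κ⁻¹.shiftH1Pk E[p^k] _ J)^[ε'] Ψ) = 0` for all `ε' ≥ ε`, all `v ∈ S`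
NOT above `p`, all `J` and ALL `Ψ ∈ H¹(K, 𝒯^{(k)}_J(E, κ⁻¹))` (the places above `p` are the per-class clause of the
test pair, not covered here). [cite: MilneADT2006, Ch. I §2, Thm. 2.8 (p. 31)] [cite: GreenbergLNM1716, §1] -/
theorem exists_uniform_localization_shiftH1Pk_modPkTwist_invTwist_of_isCyclotomic_of_finite
    (hκ : κ.IsCyclotomic) {S : Set (HeightOneSpectrum (𝓞 K))} (hS : S.Finite) :
    ∃ ε : ℕ, ∀ ⦃ε' : ℕ⦄, ε ≤ ε' → ∀ v ∈ S, (p : 𝓞 K) ∉ v.asIdeal → ∀ (J : ℕ)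
      (Ψ : galoisCohomology (W.modPkTwist p k κ.invTwist J) 1),
      galoisCohomology.localization (W.modPkTwist p k κ.invTwist J) (Sum.inr v) 1
        ((κ.invTwist.shiftH1Pk (W.torsionGaloisModule ((p : ℤ) ^ k)) (W.pow_nsmul_geomTorsion_eq_zero p k) J)^[ε']
          Ψ) = 0 := by
  haveI : Finite (geomTorsion W ((p : ℤ) ^ k)) :=
    finite_torsionPoints_holds W (AlgebraicClosure K)
      (pow_ne_zero _ (by exact_mod_cast (Fact.out : p.Prime).ne_zero))
  -- `κ⁻¹` has the same kernel as `κ`, hence is cyclotomic with `κ`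
  have hκ' : κ.invTwist.IsCyclotomic := by
    unfold ZpExtension.IsCyclotomic at hκ ⊢
    rw [ZpExtension.invTwist, ZpExtension.kerSubgroup_unitTwist]
    exact hκ
  obtain ⟨ε, hε⟩ := exists_uniform_localization_shiftH1Pk_iterate_eq_zero_finset_of_isCyclotomic
    (W.torsionGaloisModule ((p : ℤ) ^ k)) (W.pow_nsmul_geomTorsion_eq_zero p k) κ.invTwist hκ'
    (hS.toFinset.filter fun v => (p : 𝓞 K) ∉ v.asIdeal) (fun v hv => (Finset.mem_filter.1 hv).2)
  exact ⟨ε, fun ε' hε' v hv hpv J Ψ =>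
    hε hε' v (Finset.mem_filter.2 ⟨hS.mem_toFinset.2 hv, hpv⟩) J Ψ⟩

/-- **The same in the stub's `twistModPkShiftEmbed ∘ twistModPkTruncate` spelling — literally the `v ∈ S`, `v ∤ p`
instances of the last conjunct of `stub_testCocyclePkLevelX9` (`k = d + 1`, `J = L`, `ε' = ε`), for EVERY class `Ψ`:**
for `κ` cyclotomic and a finite set `S` of places there is ONE `ε` such that for all `ε' ≥ ε`, all `v ∈ S` not above
`p`, all levels `J` and all `Ψ ∈ H¹(K, W.modPkTwist p k κ.invTwist J)`,
`loc_v (H¹(twistModPkShiftEmbed J (J − ε')) (H¹(twistModPkTruncate J (J − ε')) Ψ)) = 0`.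
[cite: MilneADT2006, Ch. I §2, Thm. 2.8 (p. 31)] [cite: GreenbergLNM1716, §1] -/
theorem exists_uniform_localization_map_shiftEmbed_truncate_modPkTwist_invTwist_of_finite
    (hκ : κ.IsCyclotomic) {S : Set (HeightOneSpectrum (𝓞 K))} (hS : S.Finite) :
    ∃ ε : ℕ, ∀ ⦃ε' : ℕ⦄, ε ≤ ε' → ∀ v ∈ S, (p : 𝓞 K) ∉ v.asIdeal → ∀ (J : ℕ)
      (Ψ : galoisCohomology (W.modPkTwist p k κ.invTwist J) 1),
      galoisCohomology.localization (W.modPkTwist p k κ.invTwist J) (Sum.inr v) 1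
        (galoisCohomology.map
          (κ.invTwist.twistModPkShiftEmbed (W.torsionGaloisModule ((p : ℤ) ^ k))
            (W.pow_nsmul_geomTorsion_eq_zero p k) J (Nat.sub_le J ε')) 1
          (galoisCohomology.map
            (κ.invTwist.twistModPkTruncate (W.torsionGaloisModule ((p : ℤ) ^ k))
              (W.pow_nsmul_geomTorsion_eq_zero p k) J (Nat.sub_le J ε')) 1 Ψ)) = 0 := by
  obtain ⟨ε, hε⟩ :=
    exists_uniform_localization_shiftH1Pk_modPkTwist_invTwist_of_isCyclotomic_of_finite W p k κ hκ hS
  refine ⟨ε, fun ε' hε' v hv hpv J Ψ => ?_⟩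
  rw [map_twistModPkShiftEmbed_map_twistModPkTruncate_eq_shiftH1Pk_iterate]
  exact hε hε' v hv hpv J Ψ

end Curve

end Summit.BirchSwinnertonDyer.BirchSwinnertonDyer.Theorems.OneSidedTwistSqueezeX9KatoDivisibilityX9LocalExponentPkUniform

end
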